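import Summits.HodgeConjecture.CorCM.Census.CoinvariantSplitTypes

/-!
# The coinvariant fibre `φ₂(G, c)`, VIII: the SPLIT-CYCLIC case `G = ⟨g⟩ ⊔ c⟨g⟩`, `ord g` even — `φ₂ = β − 2` EXACTLY

COR-CM (cell `pub-hodgecm2`), count-neutral kernel combinatorics by the binder seat b09 (gen 29; lane COINVARIANT-FLOOR),
part VIII, sequel of `Census/CoinvariantSplitTypes.lean` (VII).  Theorems only; no `decide`, no certificate, no named fact, no
`sorry`.  HONEST FRAMING: `HC_CM` is NOT proved; nothing here is a period or a headline.

THE THEOREM (`fibreTwo_add_two_eq_card_block_of_split`).  Let `c` be a central involution of the finite group `G` and `g ∈ G`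
an element of EVEN order `m` with `c ∉ ⟨g⟩` and `G = ⟨g⟩ ∪ c⟨g⟩` (so `G ≅ C₂ × C_m`; e.g. `ℤ/2×ℤ/10`, `ℤ/6×ℤ/2`, `ℤ/4×ℤ/2` and
`ℤ/8×ℤ/2` with `c ∉ 2G`, `ℤ/2×ℤ/12 (c ∉ 2G)`, `ℤ/2×ℤ/14`; Galois groups of `L(√−d)` for a real cyclic field `L` of even degree).
Then **`φ₂(G, c) + 2 = β(G, c)`**: the coinvariant floor equals the parity floor `β − 1 − δ`, `δ = 1` — André-3's «split ⇒ TWO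
relations, `μ = #blocks − 2`» (PORTFOLIO-g15 §0 (C)(2)) as an exact statement about `fibre₂` for this whole family (`54, 6, 2, 18,
178, 594, 2066` on the rows above; gen 28 numerics), no census.  (For `m` odd, `G` is cyclic and part VI gives `φ₂ + 1 = β`.)

PROOF — part VI's argument with two `g`-orbits on `G` (`mem_rad2_of_par2_eq_zero_of_split`): a Hodge vector `x` with zero block
sums is `(·g⁻¹ − 1) z` modulo pairs (VII §2); `ts2 z` changes by a constant `a` under `P ↦ Pg`; the half block-sum of the
half-interval type corrects `a` to `0` (VII §3); a `g`-invariant function on `G = ⟨g⟩ ⊔ c⟨g⟩` is `ts2(b[⟨g⟩] + b'[c⟨g⟩])` and the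
subgroup types are fixed by `·g⁻¹` (VII §1); what is left has type sum `0`, is a Hodge vector mod `2` (part V), and its
`g`-coboundary lies in `rad2`.  With `δ = 1` (VII §4): `β − 2 ≤ φ₂ ≤ dim par2(hodge2) = β − 2`.

## References
* [Pohlmann1968] H. Pohlmann, Algebraic cycles on abelian varieties of complex multiplication type, Ann. of Math. 88 (1968), Thm 1.
-/

namespace Summit.HodgeConjecture.CorCM.Census.Coinvariant

open Finset
open Summit.HodgeConjecture.CorCM.Prior.AllgGroup.RfwfAllgGroup
open Summit.HodgeConjecture.CorCM.Census.BlockParity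

noncomputable section

variable {G : Type*} [Group G] [Fintype G] [DecidableEq G] (c : G)

/-! ## §4 `hodge2 ∩ ker par2 ≤ rad2` and `φ₂ + 2 = β` in the split-cyclic case -/

/-- **KEY (split-cyclic)**: a Hodge vector mod `2` with zero block sums lies in `rad2`. [folklore] -/
theorem mem_rad2_of_par2_eq_zero_of_split (hc2 : c * c = 1) (hc1 : c ≠ 1) (hcen : ∀ x : G, x * c = c * x) {g : G}
    (hcov : ∀ Q : G, (∃ k : ℕ, Q = g ^ k) ∨ ∃ k : ℕ, Q = c * g ^ k) (hng : ∀ k : ℕ, c ≠ g ^ k) (hm : Even (orderOf g))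
    {x : CMF G c →₀ ZMod 2} (hx : x ∈ hodge2 c hc2) (hpx : par2 c x = 0) :
    x ∈ rad2 c hc2 := by
  obtain ⟨z, p, hp, hzp⟩ := exists_sub_add_eq_of_par2_eq_zero c hcen hcov hpx
  obtain ⟨s, hs⟩ := exists_sub_eq_red_pair_of_split c hc2 hcen hcov hng hm
  -- `x − p = z·g⁻¹ − z` is a Hodge vector with constant type sum `a`
  have hxp : Finsupp.mapDomain (rt c g) z - z ∈ hodge2 c hc2 := by
    have e : Finsupp.mapDomain (rt c g) z - z = x - p := by rw [← hzp]; abel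
    rw [e]; exact Submodule.sub_mem _ hx (le_sup_right (a := face2 c hc2) hp)
  obtain ⟨a, ha⟩ := exists_forall_ts2_eq_of_mem_hodge2 c hc2 hcen hxp
  have hzdiff : ∀ P, ts2 c z (P * g) - ts2 c z P = a := fun P => by
    rw [← ts2_mapDomain_rt, ← Pi.sub_apply, ← map_sub, ha]
  have hsdiff : ∀ P, ts2 c s (P * g) - ts2 c s P = 1 := fun P => by
    rw [← ts2_mapDomain_rt, ← Pi.sub_apply, ← map_sub, hs, ts2_red_pair c hcen]
  -- correct by `a·s`, then by the subgroup types
  set z' := z - a • s with hz'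
  have hinv : ∀ P, ts2 c z' (P * g) = ts2 c z' P := fun P => by
    have h1 := hzdiff P
    have h2 := hsdiff P
    rw [hz', map_sub, map_smul, Pi.sub_apply, Pi.sub_apply, Pi.smul_apply, Pi.smul_apply, smul_eq_mul, smul_eq_mul]
    linear_combination h1 - a * h2
  set A₀ := sgp c hc2 hcov hng with hA₀
  set w := z' - ts2 c z' 1 • Finsupp.single A₀ (1 : ZMod 2) - ts2 c z' c • Finsupp.single (rt c c A₀) (1 : ZMod 2) with hw
  have hw0 : ∀ P, ts2 c w P = 0 := by
    intro P
    have hcP : P ∈ (rt c c A₀).1 ↔ P ∉ A₀.1 := by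
      rw [mem_rt, hcen]
      constructor
      · intro h1 h2; exact ((A₀.2 P).mp h2) h1
      · intro h1; by_contra h2; exact h1 ((A₀.2 P).mpr h2)
    simp only [hw, map_sub, map_smul, Pi.sub_apply, Pi.smul_apply, ts2_single, smul_eq_mul]
    rcases eq_or_eq_of_mul_invariant c hc2 hcov hng hinv P with ⟨hP, hv⟩ | ⟨hP, hv⟩
    · rw [if_pos hP, if_neg (fun h' => (hcP.mp h') hP), hv]; ring
    · rw [if_neg hP, if_pos (hcP.mpr hP), hv]; ring
  have hwH : w ∈ hodge2 c hc2 := mem_hodge2_of_forall_ts2_eq c hc2 hc1 hcen (a := 0) hw0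
  -- the `g`-coboundaries of the subgroup types vanish
  have hDA : Finsupp.mapDomain (rt c g) (Finsupp.single A₀ (1 : ZMod 2)) - Finsupp.single A₀ 1 = 0 := by
    rw [Finsupp.mapDomain_single, hA₀, rt_sgp, sub_self]
  have hDA' : Finsupp.mapDomain (rt c g) (Finsupp.single (rt c c A₀) (1 : ZMod 2)) - Finsupp.single (rt c c A₀) 1 = 0 := by
    rw [Finsupp.mapDomain_single, hA₀, rt_rt_sgp c hc2 hcen hcov hng, sub_self]
  -- assemble
  have e : x = (Finsupp.mapDomain (rt c g) w - w) + a • (Finsupp.mapDomain (rt c g) s - s) +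
      ts2 c z' 1 • (Finsupp.mapDomain (rt c g) (Finsupp.single A₀ (1 : ZMod 2)) - Finsupp.single A₀ 1) +
      ts2 c z' c • (Finsupp.mapDomain (rt c g) (Finsupp.single (rt c c A₀) (1 : ZMod 2)) -
        Finsupp.single (rt c c A₀) 1) + p := by
    rw [← hzp, hw, hz']
    simp only [Finsupp.mapDomain_sub, Finsupp.mapDomain_smul]
    module
  rw [e, hDA, hDA', smul_zero, smul_zero, add_zero, add_zero, hs]
  exact Submodule.add_mem _ (Submodule.add_mem _ (mapDomain_rt_sub_mem_rad2 c hc2 hcen g hwH)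
    (Submodule.smul_mem _ _ (pair2_le_rad2 c hc2 (red_mem_pair2 c (Submodule.subset_span (pair_mem_pairSet c _))))))
    (pair2_le_rad2 c hc2 hp)

/-- **`φ₂ ≤ dim par2(hodge2)`** in the split-cyclic case. [folklore] -/
theorem fibreTwo_le_finrank_span_par_of_split (hc2 : c * c = 1) (hc1 : c ≠ 1) (hcen : ∀ x : G, x * c = c * x) {g : G}
    (hcov : ∀ Q : G, (∃ k : ℕ, Q = g ^ k) ∨ ∃ k : ℕ, Q = c * g ^ k) (hng : ∀ k : ℕ, c ≠ g ^ k) (hm : Even (orderOf g)) :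
    fibreTwo c hc2 ≤ Module.finrank (ZMod 2) ↥(Submodule.span (ZMod 2) (par c '' gfaceSet G c hc2)) := by
  rw [span_par_gfaceSet_eq_map, ← map_par2_hodge2]
  have h1 := LinearMap.finrank_range_add_finrank_ker (V := ↥(hodge2 c hc2)) ((par2 c).domRestrict (hodge2 c hc2))
  rw [LinearMap.range_domRestrict, LinearMap.ker_domRestrict] at h1
  have h2 : Submodule.comap (hodge2 c hc2).subtype (LinearMap.ker (par2 c)) ≤
      Submodule.comap (hodge2 c hc2).subtype (rad2 c hc2) := fun v hv =>
    mem_rad2_of_par2_eq_zero_of_split c hc2 hc1 hcen hcov hng hm v.2 (LinearMap.mem_ker.mp hv)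
  have h3 := Submodule.finrank_mono h2
  rw [(Submodule.comapSubtypeEquivOfLe (rad2_le_hodge2 c hc2)).finrank_eq] at h3
  have h4 := finrank_rad2_add_fibreTwo c hc2
  omega

/-- **THE SPLIT-CYCLIC COINVARIANT THEOREM: `φ₂(G, c) + 2 = β(G, c)`** when `G = ⟨g⟩ ⊔ c⟨g⟩`, `c ∉ ⟨g⟩` central, `ord g` even
(`G ≅ C₂ × C_m`, `m` even: `ℤ/2×ℤ/10 54`, `ℤ/6×ℤ/2 6`, `ℤ/8×ℤ/2 (c ∉ 2G) 18`, `ℤ/2×ℤ/12 (c ∉ 2G) 178`, `ℤ/2×ℤ/14 594`, …). [folklore] -/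
theorem fibreTwo_add_two_eq_card_block_of_split (hc2 : c * c = 1) (hc1 : c ≠ 1) (hcen : ∀ x : G, x * c = c * x) {g : G}
    (hcov : ∀ Q : G, (∃ k : ℕ, Q = g ^ k) ∨ ∃ k : ℕ, Q = c * g ^ k) (hng : ∀ k : ℕ, c ≠ g ^ k) (hm : Even (orderOf g)) :
    fibreTwo c hc2 + 2 = Fintype.card (Block c) := by
  obtain ⟨T, hT⟩ := exists_isCMF c hc2 hc1
  have h1 := finrank_span_par_gfaceSet_add c hc2 ⟨T, hT⟩
  have h2 := fibreTwo_le_finrank_span_par_of_split c hc2 hc1 hcen hcov hng hm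
  have h3 := card_block_le_fibreTwo_add c hc2 ⟨T, hT⟩
  have h4 := wdelta_eq_one_of_split c hc2 hc1 hcen hcov hng hm ⟨T, hT⟩
  omega

/-- **The two floors coincide in the split-cyclic case**: `φ₂ = dim_𝔽₂ span par(faces)` (`= β − 2`). [folklore] -/
theorem fibreTwo_eq_finrank_span_par_of_split (hc2 : c * c = 1) (hc1 : c ≠ 1) (hcen : ∀ x : G, x * c = c * x) {g : G}
    (hcov : ∀ Q : G, (∃ k : ℕ, Q = g ^ k) ∨ ∃ k : ℕ, Q = c * g ^ k) (hng : ∀ k : ℕ, c ≠ g ^ k) (hm : Even (orderOf g)) :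
    fibreTwo c hc2 = Module.finrank (ZMod 2) ↥(Submodule.span (ZMod 2) (par c '' gfaceSet G c hc2)) :=
  le_antisymm (fibreTwo_le_finrank_span_par_of_split c hc2 hc1 hcen hcov hng hm) (finrank_span_par_le_fibreTwo c hc2)

end

end Summit.HodgeConjecture.CorCM.Census.Coinvariant
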